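import Summits.Ventures.HSemireg.SignedPureWeilTransport

/-!
# Venture HSemireg — THE SIGN LADDER AND THE MASS LADDER ARE SHARP FOR EVERY n: an explicit pure W-alive {0, ±1}-valued design
# on (ℤ∕4)ⁿ with 2^{⌈(3n−2)∕2⌉} letters for every n ≥ 1 (rung1, rung2, and two levels up at a time by the twisted sum with rung2),
# whose Weil moment W has |Re W| + |Im W| = 2^{⌈(3n−2)∕2⌉} = Σ_x |m(x)|

HONEST FRAMING. Part of the Lean index of the computation cell `pub-hsemireg` (Sunday typer seat p9, § g = 8; family B row **B20-3** of
`target-g8/CENSUS.md`: signed pure-Weil unit-graph designs are «class witnesses — cycles with ℤ-coefficients — not census objects»).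
FINITE INTEGER ∕ GAUSSIAN-INTEGER ARITHMETIC ONLY, in the vocabulary of `SignedPureWeilLadder.lean` ∕ `SignedPureWeilTransport.lean`
(`Letter`, `Eps`, `vmoment`, `plus`, `minus`, `supp`, `rung1`, `rung2`, `tensor`, `shift`, `twist`, `appendEquiv`, `unitVec`,
`vchi_unitVec`, `twist_pure`, `vmoment_twist`). No abelian variety, cycle, sheaf or semiregularity map is constructed; t-20's dictionary
(LEMMA W) is text of record, not a binder; nothing here says that HC ∕ HC_CM ∕ HC_AV holds; no object is certified; no Literature fact is
declared; no verdict ∕ door word ∕ count of the cell moves.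

THE STATEMENTS. Write F(n) = 2^{⌈(3n−2)∕2⌉} = 2^{⌊(3n−1)∕2⌋} (2, 4, 16, 32, 128, 256, 1 024, 2 048, … ; F(n+2) = 8·F(n)). Of record (p9 row G
`SignedPureWeilDyadicMoment.lean`, draft a731a8b2d362b0c0, ladder key 419 ↔ 06:10Z Wed 2026-08-26 — NOT imported here): for every pure W-alive integer design `m`
on (ℤ∕4)ⁿ, `(1+i)^{3n−2} ∣ W`, hence |Re W| + |Im W| ≥ F(n) (`weil_gmass_floor`) and Σ_x |m(x)| ≥ F(n) (`l1_floor`), so a {0, ±1}-valued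
(«sign») design has ≥ F(n) letters (`sign_design_floor`); sharpness was known there for n ≤ 6 by the explicit designs rung1, rung2,
design14 ∕ rung3, design28 ∕ T32, sign128, sign256 ∕ design184. THIS FILE gives the matching UPPER side FOR EVERY n, by one uniform
construction: **`signLadder n`** = rung1 (n = 1), rung2 (n = 2), and `stepTwo (signLadder (n−2))` for n ≥ 3, where
`stepTwo m = m ⊗ rung2 + m(· + e₁) ⊗ rung2(· + (3,0))` is the twisted sum of `SignedPureWeilTransport.lean` (`twist`) with the 4-letter
rung: it is pure (`twist_pure`), its Weil moment is EXACTLY `8·W(m)` (`vmoment_stepTwo_plus`: corner factor 2, W(rung2) = 4), it is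
{0, ±1}-valued when `m` is (the two summands never meet: `rung2(y)·rung2(y + (3,0)) = 0`), and its ℓ¹-mass is at most `8·Σ|m|`
(`l1_twist_le`) and at least |Re 8W| + |Im 8W| = 8·(|Re W| + |Im W|) (`abs_re_add_abs_im_le_l1`, termwise) — so the equality
«Σ|m| = |Re W| + |Im W| = F» climbs the ladder two levels at a time (`signLadder_spec`). RESULTS: **`sign_ladder_upper`** — for every
n ≥ 1 a pure W-alive {0, ±1}-valued design on (ℤ∕4)ⁿ with exactly F(n) letters; **`mass_ladder_upper`** — for every n ≥ 1 a pure W-alive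
design with Σ_x |m(x)| = |Re W| + |Im W| = F(n). WITH ROW G's floors these read: **s±(n) = F(n) and min Σ|m| = F(n) for every n** (the sign
ladder and the mass ladder are EXACT in closed form; the dyadic theorem is sharp at every level), of which `sign_ladder_exact` (n ≤ 4),
`ssign5_le_128`, `ssign6_le_256` and `sharpness` (n ≤ 6) of rows G ∕ I ∕ J are the first instances. Instances stated here: n = 5, 6, 7, 8
(128, 256, 1 024, 2 048 letters). For the SUPPORT ladder s(n) (all integer values allowed) these designs are not minimal from n = 3 on
(s(3) = 14 < 16, s(4) = 28 < 32, s(5) ≤ 80 < 128, s(6) ≤ 184 < 256); they bound the growth rate: s(n)^{1∕n} ≤ F(n)^{1∕n} → 2^{3∕2}.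

§5 THE WEIL IMAGE: `norm_vmoment_signLadder` — N(W(signLadder n)) = 2^{3n−2}, so (given row G's `(1+i)^{3n−2} ∣ W`) W(signLadder n)
GENERATES the ideal (1+i)^{3n−2}; `exists_pure_vmoment_eq_mul` — every Gaussian multiple c·W(signLadder n) is the Weil moment of a pure
integer design on (ℤ∕4)ⁿ (Re c·m − Im c·m(· + e₁)); hence, with row G, **the set of Weil moments of pure integer designs on (ℤ∕4)ⁿ is
EXACTLY the ideal (1+i)^{3n−2}·ℤ[i] for every n ≥ 1** — the all-n form of the machine statement (n ≤ 5, Hermite normal form) of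
`HOME/p9/STRUCTURE-DYADIC-p9g10.md`.

WHAT IS NOT HERE. The floors and the valuation (row G); anything about s(n) beyond the trivial `s(n) ≤ F(n)`; LEMMA W; sheaves or
semiregularity.
-/

namespace Summit.Ventures.HSemireg.SignedWeilDesignN

open Finset

variable {n a b : ℕ}

/-! ## §1 ℓ¹-mass: termwise bound for the moments, tensor and twisted sums, sign-valued designs -/

/-- Real and imaginary parts of `Σ_x m(x)·g(x)` for integer weights. -/
theorem re_im_sum_intCast_mul (s : Finset (Letter n)) (m : Letter n → ℤ) (g : Letter n → GaussianInt) :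
    (∑ x ∈ s, (m x : GaussianInt) * g x).re = ∑ x ∈ s, m x * (g x).re ∧
    (∑ x ∈ s, (m x : GaussianInt) * g x).im = ∑ x ∈ s, m x * (g x).im := by
  classical
  induction s using Finset.induction_on with
  | empty => simp
  | insert a s ha ih =>
    rw [Finset.sum_insert ha, Finset.sum_insert ha, Finset.sum_insert ha]
    constructor
    · simp [Zsqrtd.re_add, Zsqrtd.re_mul, ih.1]
    · simp [Zsqrtd.im_add, Zsqrtd.im_mul, ih.2]

/-- `|Re i^k| + |Im i^k| = 1`. -/
theorem unitTab_abs_re_add_abs_im : ∀ k : Fin 4, |(unitTab k).re| + |(unitTab k).im| = 1 := by decide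

/-- **TERMWISE:** `|Re m̂(ε)| + |Im m̂(ε)| ≤ Σ_x |m(x)|` for every pattern (each character value is ±1 or ±i). -/
theorem abs_re_add_abs_im_le_l1 (m : Letter n → ℤ) (ε : Eps n) :
    |(vmoment m ε).re| + |(vmoment m ε).im| ≤ ∑ x, |m x| := by
  obtain ⟨hre, him⟩ := re_im_sum_intCast_mul Finset.univ m (vchi ε)
  unfold vmoment
  rw [hre, him]
  calc |∑ x, m x * (vchi ε x).re| + |∑ x, m x * (vchi ε x).im|
      ≤ (∑ x, |m x * (vchi ε x).re|) + ∑ x, |m x * (vchi ε x).im| :=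
        add_le_add (Finset.abs_sum_le_sum_abs _ _) (Finset.abs_sum_le_sum_abs _ _)
    _ = ∑ x, |m x| * (|(vchi ε x).re| + |(vchi ε x).im|) := by
        rw [← Finset.sum_add_distrib]
        exact Finset.sum_congr rfl (fun x _ => by rw [abs_mul, abs_mul]; ring)
    _ = ∑ x, |m x| := Finset.sum_congr rfl (fun x _ => by rw [vchi, unitTab_abs_re_add_abs_im, mul_one])

/-- The ℓ¹-mass of a tensor product is the product of the masses. -/
theorem l1_tensor (m₁ : Letter a → ℤ) (m₂ : Letter b → ℤ) :
    (∑ x, |tensor m₁ m₂ x|) = (∑ x₁, |m₁ x₁|) * ∑ x₂, |m₂ x₂| := by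
  rw [← (appendEquiv a b).sum_comp, Fintype.sum_prod_type, Finset.sum_mul_sum]
  refine Finset.sum_congr rfl (fun x₁ _ => Finset.sum_congr rfl (fun x₂ _ => ?_))
  simp only [appendEquiv, Equiv.coe_fn_mk, tensor_append, abs_mul]

/-- The ℓ¹-mass of a translate is the mass. -/
theorem l1_shift (m : Letter n → ℤ) (t : Letter n) : (∑ x, |shift m t x|) = ∑ x, |m x| :=
  Equiv.sum_comp (Equiv.addRight t) (fun x => |m x|)

/-- **THE ℓ¹-MASS OF A TWISTED SUM** is at most twice the product of the masses. -/
theorem l1_twist_le (m₁ : Letter a → ℤ) (m₂ : Letter b → ℤ) (t : Letter a) (s : Letter b) :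
    (∑ x, |twist m₁ m₂ t s x|) ≤ 2 * ((∑ x₁, |m₁ x₁|) * ∑ x₂, |m₂ x₂|) := by
  calc (∑ x, |twist m₁ m₂ t s x|)
      ≤ ∑ x, (|tensor m₁ m₂ x| + |tensor (shift m₁ t) (shift m₂ s) x|) :=
        Finset.sum_le_sum (fun x _ => abs_add_le _ _)
    _ = 2 * ((∑ x₁, |m₁ x₁|) * ∑ x₂, |m₂ x₂|) := by
        rw [Finset.sum_add_distrib, l1_tensor, l1_tensor, l1_shift, l1_shift]; ring

/-- For a {0, ±1}-valued design the number of letters is the ℓ¹-mass. -/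
theorem card_supp_eq_l1_of_sign (m : Letter n → ℤ) (hm : ∀ x, |m x| ≤ 1) : ((supp m).card : ℤ) = ∑ x, |m x| := by
  rw [supp, Finset.card_filter]
  push_cast
  refine Finset.sum_congr rfl (fun x _ => ?_)
  by_cases h : m x = 0
  · simp [h]
  · have h1 : |m x| = 1 := le_antisymm (hm x) (Int.one_le_abs h)
    simp [h, h1]

/-- `|Re 8z| + |Im 8z| = 8·(|Re z| + |Im z|)`. -/
theorem abs_re_add_abs_im_eight_mul (z : GaussianInt) : |(8 * z).re| + |(8 * z).im| = 8 * (|z.re| + |z.im|) := by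
  have h8 : (8 : GaussianInt) = ((8 : ℤ) : GaussianInt) := by norm_num
  rw [h8]
  simp only [Zsqrtd.re_mul, Zsqrtd.im_mul, Zsqrtd.re_intCast, Zsqrtd.im_intCast, zero_mul, mul_zero, add_zero, abs_mul]
  norm_num
  ring

/-! ## §2 One step up the ladder by two levels: the twisted sum with rung2 -/

/-- The first unit vector `e₁ = (1, 0, …, 0) ∈ (ℤ∕4)ⁿ` (the empty vector when n = 0). [definition of this file] -/
def e1 (n : ℕ) : Letter n := fun k => if k.val = 0 then 1 else 0

/-- The translation `(3, 0) ∈ (ℤ∕4)²` of the second summand's rung. [definition of this file] -/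
def s2 : Letter 2 := ![3, 0]

/-- **THE STEP:** `stepTwo m = m ⊗ rung2 + m(· + e₁) ⊗ rung2(· + (3,0))` on (ℤ∕4)ⁿ⁺². [definition of this file] -/
def stepTwo (m : Letter n → ℤ) : Letter (n + 2) → ℤ := twist m rung2 (e1 n) s2

/-- `e₁` is the unit vector of `SignedPureWeilTransport.lean` when n ≥ 1. -/
theorem e1_eq_unitVec (hn : 0 < n) : e1 n = unitVec hn 1 := by
  funext k
  simp only [e1, unitVec, Fin.ext_iff]

/-- `i^{(+,…,+)·(−e₁)} = −i`. -/
theorem vchi_plus_neg_e1 (hn : 0 < n) : vchi (plus : Eps n) (-e1 n) = unitTab 3 := by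
  rw [e1_eq_unitVec hn, show (plus : Eps n) = fun _ => 1 from rfl, vchi_unitVec]; decide

/-- `i^{(−,…,−)·(−e₁)} = i`. -/
theorem vchi_minus_neg_e1 (hn : 0 < n) : vchi (minus : Eps n) (-e1 n) = unitTab 1 := by
  rw [e1_eq_unitVec hn, show (minus : Eps n) = fun _ => 2 from rfl, vchi_unitVec]; decide

/-- The two character values of the translation `(3, 0)` at the Weil patterns of (ℤ∕4)². -/
theorem vchi_neg_s2 : vchi (plus : Eps 2) (-s2) = unitTab 1 ∧ vchi (minus : Eps 2) (-s2) = unitTab 3 := by decide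

/-- The facts about rung2 used by the step: pure, W = 4, mass 4, {0, ±1}-valued, and the rung never meets its (3,0)-translate. -/
theorem rung2_facts :
    (∀ ε : Eps 2, ε ≠ plus → ε ≠ minus → vmoment rung2 ε = 0) ∧ vmoment rung2 plus = 4 ∧ (∑ y, |rung2 y|) = 4 ∧
    (∀ y, |rung2 y| ≤ 1) ∧ (∀ y : Letter 2, rung2 y = 0 ∨ rung2 (y + s2) = 0) :=
  ⟨rungs_certificate.2.1.1, by decide +kernel, by decide +kernel, by decide +kernel, by decide +kernel⟩

/-- **THE STEP IS PURE** (n ≥ 1): the twist kills the two cross patterns (`(−i)·(−i) = −1 = i·i`). -/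
theorem stepTwo_pure (hn : 0 < n) (m : Letter n → ℤ) (hpure : ∀ ε : Eps n, ε ≠ plus → ε ≠ minus → vmoment m ε = 0) :
    ∀ ε : Eps (n + 2), ε ≠ plus → ε ≠ minus → vmoment (stepTwo m) ε = 0 :=
  twist_pure m rung2 (e1 n) s2 hpure rung2_facts.1
    (by rw [vchi_plus_neg_e1 hn, vchi_neg_s2.2]; decide) (by rw [vchi_minus_neg_e1 hn, vchi_neg_s2.1]; decide)

/-- **THE WEIL MOMENT OF THE STEP IS EXACTLY 8·W(m)** (corner factor `1 + (−i)·i = 2`, times W(rung2) = 4). -/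
theorem vmoment_stepTwo_plus (hn : 0 < n) (m : Letter n → ℤ) : vmoment (stepTwo m) plus = 8 * vmoment m plus := by
  rw [stepTwo, ← (append_plus_plus (a := n) (b := 2)).1, vmoment_twist, vchi_plus_neg_e1 hn, vchi_neg_s2.1, rung2_facts.2.1]
  have h2 : (1 + unitTab 3 * unitTab 1 : GaussianInt) = 2 := by decide
  rw [h2]
  ring

/-- **THE STEP KEEPS {0, ±1}-VALUES:** at a letter `(x, y)` at most one of `rung2(y)`, `rung2(y + (3,0))` is non-zero. -/
theorem stepTwo_sign (m : Letter n → ℤ) (hm : ∀ x, |m x| ≤ 1) : ∀ z, |stepTwo m z| ≤ 1 := by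
  intro z
  obtain ⟨⟨x, y⟩, rfl⟩ := (appendEquiv n 2).surjective z
  have hz : (appendEquiv n 2) (x, y) = Fin.append x y := rfl
  rw [hz, stepTwo, twist, Pi.add_apply, tensor_append, tensor_append]
  simp only [shift]
  rcases rung2_facts.2.2.2.2 y with h | h
  · rw [h, mul_zero, zero_add, abs_mul]
    calc |m (x + e1 n)| * |rung2 (y + s2)| ≤ 1 * 1 :=
          mul_le_mul (hm _) (rung2_facts.2.2.2.1 _) (abs_nonneg _) zero_le_one
      _ = 1 := one_mul 1
  · rw [h, mul_zero, add_zero, abs_mul]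
    calc |m x| * |rung2 y| ≤ 1 * 1 := mul_le_mul (hm _) (rung2_facts.2.2.2.1 _) (abs_nonneg _) zero_le_one
      _ = 1 := one_mul 1

/-- The ℓ¹-mass of the step is at most 8 times the mass. -/
theorem l1_stepTwo_le (m : Letter n → ℤ) : (∑ z, |stepTwo m z|) ≤ 8 * ∑ x, |m x| := by
  calc (∑ z, |stepTwo m z|) ≤ 2 * ((∑ x, |m x|) * ∑ y, |rung2 y|) := l1_twist_le _ _ _ _
    _ = 8 * ∑ x, |m x| := by rw [rung2_facts.2.2.1]; ring

/-! ## §3 The ladder -/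

/-- **THE SIGN LADDER:** rung1, rung2, then two levels up at a time by `stepTwo` (level 0 carries the zero design). [definition of this file] -/
def signLadder : (n : ℕ) → (Letter n → ℤ)
  | 0 => fun _ => 0
  | 1 => rung1
  | 2 => rung2
  | n + 3 => stepTwo (signLadder (n + 1))

/-- The closed form climbs by 8 every two levels: `2^{⌊(3(n+2)−1)∕2⌋} = 8·2^{⌊(3n−1)∕2⌋}` (n ≥ 1). -/
theorem pow_floor_step (hn : 0 < n) : (2 : ℤ) ^ ((3 * (n + 2) - 1) / 2) = 8 * 2 ^ ((3 * n - 1) / 2) := by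
  rw [show (3 * (n + 2) - 1) / 2 = (3 * n - 1) / 2 + 3 by omega, pow_add]
  ring

/-- **THE LADDER INVARIANT (every n ≥ 1):** `signLadder n` is pure, {0, ±1}-valued, and its ℓ¹-mass and |Re W| + |Im W| are both
EXACTLY `2^{⌊(3n−1)∕2⌋} = 2^{⌈(3n−2)∕2⌉}`. -/
theorem signLadder_spec : ∀ n : ℕ, 0 < n →
    (∀ ε : Eps n, ε ≠ plus → ε ≠ minus → vmoment (signLadder n) ε = 0) ∧
    (∀ x, |signLadder n x| ≤ 1) ∧
    (∑ x, |signLadder n x|) = 2 ^ ((3 * n - 1) / 2) ∧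
    |(vmoment (signLadder n) plus).re| + |(vmoment (signLadder n) plus).im| = 2 ^ ((3 * n - 1) / 2)
  | 0, h => absurd h (lt_irrefl 0)
  | 1, _ => ⟨rungs_certificate.1.1, by decide +kernel, by decide +kernel, by decide +kernel⟩
  | 2, _ => ⟨rungs_certificate.2.1.1, by decide +kernel, by decide +kernel, by decide +kernel⟩
  | n + 3, _ => by
    have hn : 0 < n + 1 := Nat.succ_pos n
    obtain ⟨hp, hs, hl1, hgm⟩ := signLadder_spec (n + 1) hn
    have e : (2 : ℤ) ^ ((3 * (n + 3) - 1) / 2) = 8 * 2 ^ ((3 * (n + 1) - 1) / 2) := pow_floor_step hn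
    have hW : |(vmoment (stepTwo (signLadder (n + 1))) plus).re| + |(vmoment (stepTwo (signLadder (n + 1))) plus).im| =
        8 * 2 ^ ((3 * (n + 1) - 1) / 2) := by
      rw [vmoment_stepTwo_plus hn, abs_re_add_abs_im_eight_mul, hgm]
    have hup : (∑ z, |stepTwo (signLadder (n + 1)) z|) ≤ 8 * 2 ^ ((3 * (n + 1) - 1) / 2) :=
      (l1_stepTwo_le _).trans (by rw [hl1])
    have hlow : 8 * 2 ^ ((3 * (n + 1) - 1) / 2) ≤ ∑ z, |stepTwo (signLadder (n + 1)) z| :=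
      hW ▸ abs_re_add_abs_im_le_l1 _ plus
    refine ⟨stepTwo_pure hn _ hp, stepTwo_sign _ hs, ?_, ?_⟩
    · show (∑ z, |stepTwo (signLadder (n + 1)) z|) = _
      rw [e]; exact le_antisymm hup hlow
    · show |(vmoment (stepTwo (signLadder (n + 1))) plus).re| + |(vmoment (stepTwo (signLadder (n + 1))) plus).im| = _
      rw [e]; exact hW

/-- The ladder designs are W-alive (|Re W| + |Im W| is a power of two). -/
theorem signLadder_alive (hn : 0 < n) : vmoment (signLadder n) plus ≠ 0 := by
  intro h
  have hgm := (signLadder_spec n hn).2.2.2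
  rw [h] at hgm
  have : (0 : ℤ) < 2 ^ ((3 * n - 1) / 2) := by positivity
  simp at hgm
  omega

/-- The ladder designs have exactly `2^{⌊(3n−1)∕2⌋}` letters. -/
theorem card_supp_signLadder (hn : 0 < n) : (supp (signLadder n)).card = 2 ^ ((3 * n - 1) / 2) := by
  have h := card_supp_eq_l1_of_sign (signLadder n) (signLadder_spec n hn).2.1
  rw [(signLadder_spec n hn).2.2.1] at h
  exact_mod_cast h

/-! ## §4 Results -/

/-- **THE SIGN LADDER, UPPER SIDE, EVERY n:** for every n ≥ 1 there is a pure W-alive {0, ±1}-valued design on (ℤ∕4)ⁿ with exactly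
`2^{⌊(3n−1)∕2⌋} = 2^{⌈(3n−2)∕2⌉}` letters — with row G's `sign_design_floor` (of record) the minimal support of a pure W-alive SIGN design is
s±(n) = 2^{⌈(3n−2)∕2⌉} for every n. -/
theorem sign_ladder_upper (n : ℕ) (hn : 0 < n) :
    ∃ m : Letter n → ℤ, (∀ ε : Eps n, ε ≠ plus → ε ≠ minus → vmoment m ε = 0) ∧ vmoment m plus ≠ 0 ∧
      (∀ x, |m x| ≤ 1) ∧ (supp m).card = 2 ^ ((3 * n - 1) / 2) :=
  ⟨signLadder n, (signLadder_spec n hn).1, signLadder_alive hn, (signLadder_spec n hn).2.1, card_supp_signLadder hn⟩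

/-- **THE MASS LADDER, UPPER SIDE, EVERY n:** for every n ≥ 1 there is a pure W-alive integer design on (ℤ∕4)ⁿ whose ℓ¹-mass and whose
|Re W| + |Im W| both equal `2^{⌈(3n−2)∕2⌉}` — with row G's `l1_floor` ∕ `weil_gmass_floor` (of record) the minimal ℓ¹-mass of a pure W-alive
design is exactly `2^{⌈(3n−2)∕2⌉}` and the dyadic valuation theorem `(1+i)^{3n−2} ∣ W` is sharp, for every n. -/
theorem mass_ladder_upper (n : ℕ) (hn : 0 < n) :
    ∃ m : Letter n → ℤ, (∀ ε : Eps n, ε ≠ plus → ε ≠ minus → vmoment m ε = 0) ∧ vmoment m plus ≠ 0 ∧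
      (∑ x, |m x|) = 2 ^ ((3 * n - 1) / 2) ∧ |(vmoment m plus).re| + |(vmoment m plus).im| = 2 ^ ((3 * n - 1) / 2) :=
  ⟨signLadder n, (signLadder_spec n hn).1, signLadder_alive hn, (signLadder_spec n hn).2.2.1, (signLadder_spec n hn).2.2.2⟩

/-- **INSTANCES n = 5, 6, 7, 8:** pure W-alive sign designs with 128, 256, 1 024 and 2 048 letters (the first two are the numbers of rows
I ∕ J's explicit `sign128` ∕ `sign256`; the last two are new levels). -/
theorem sign_ladder_instances :
    (supp (signLadder 5)).card = 128 ∧ (supp (signLadder 6)).card = 256 ∧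
    (supp (signLadder 7)).card = 1024 ∧ (supp (signLadder 8)).card = 2048 := by
  refine ⟨?_, ?_, ?_, ?_⟩ <;> rw [card_supp_signLadder (by norm_num)] <;> norm_num

/-! ## §5 The Weil image contains a generator of `(1+i)^{3n−2}` at every level -/

/-- **N(W(signLadder n)) = 2^{3n−2}** (W(rung1) = 1 − i, W(rung2) = 4, and each step multiplies W by 8): with the dyadic valuation
`(1+i)^{3n−2} ∣ W` of row G (of record) this says that `W(signLadder n)` GENERATES the ideal `(1+i)^{3n−2}` of ℤ[i]. -/
theorem norm_vmoment_signLadder : ∀ n : ℕ, 0 < n → (vmoment (signLadder n) plus).norm = 2 ^ (3 * n - 2)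
  | 0, h => absurd h (lt_irrefl 0)
  | 1, _ => by decide +kernel
  | 2, _ => by decide +kernel
  | n + 3, _ => by
    have hn : 0 < n + 1 := Nat.succ_pos n
    show (vmoment (stepTwo (signLadder (n + 1))) plus).norm = _
    rw [vmoment_stepTwo_plus hn, Zsqrtd.norm_mul, norm_vmoment_signLadder (n + 1) hn]
    have h8 : (8 : GaussianInt).norm = 64 := by decide
    rw [h8, show 3 * (n + 3) - 2 = 6 + (3 * (n + 1) - 2) by omega, pow_add]
    norm_num

/-- Moments of an integer combination of two designs. -/
theorem vmoment_lincomb (c d : ℤ) (m m' : Letter n → ℤ) (ε : Eps n) :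
    vmoment (fun x => c * m x + d * m' x) ε = (c : GaussianInt) * vmoment m ε + (d : GaussianInt) * vmoment m' ε := by
  unfold vmoment
  rw [Finset.mul_sum, Finset.mul_sum, ← Finset.sum_add_distrib]
  exact Finset.sum_congr rfl (fun x _ => by push_cast; ring)

/-- **THE WEIL IMAGE CONTAINS `ℤ[i]·W(signLadder n)`:** for every Gaussian integer `c` the pure integer design
`Re c·m − Im c·m(· + e₁)` (`m = signLadder n`; the translate has Weil moment `−i·W`) has Weil moment `c·W(signLadder n)`. With row G's
valuation (of record) the set of Weil moments of pure integer designs on (ℤ∕4)ⁿ is therefore EXACTLY the ideal `(1+i)^{3n−2}·ℤ[i]` for every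
n ≥ 1 — the all-n form of the machine statement «the W-image is exactly the ideal for n ≤ 5» of `HOME/p9/STRUCTURE-DYADIC-p9g10.md`. -/
theorem exists_pure_vmoment_eq_mul (hn : 0 < n) (c : GaussianInt) :
    ∃ m : Letter n → ℤ, (∀ ε : Eps n, ε ≠ plus → ε ≠ minus → vmoment m ε = 0) ∧
      vmoment m plus = c * vmoment (signLadder n) plus := by
  obtain ⟨hp, -, -, -⟩ := signLadder_spec n hn
  refine ⟨fun x => c.re * signLadder n x + (-c.im) * shift (signLadder n) (e1 n) x, fun ε hεp hεm => ?_, ?_⟩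
  · rw [vmoment_lincomb, vmoment_shift, hp ε hεp hεm, mul_zero, mul_zero, mul_zero, add_zero]
  · rw [vmoment_lincomb, vmoment_shift, vchi_plus_neg_e1 hn, ← mul_assoc, ← add_mul]
    congr 1
    have hc : c = ⟨c.re, c.im⟩ := rfl
    conv_rhs => rw [hc]
    ext <;> simp [unitTab]

end Summit.Ventures.HSemireg.SignedWeilDesignN
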